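/-
Copyright (c) 2026 the pub-hodgecm-mathlib formalisation cell (harness21).  Prover seat hodgecm-mathlib-F0P3a-p06 (g20) on line LH3 (closer stub `stub_N9`, N9 «Transf» road),
letter L3′ SURJ-OF-FORWARD road (LH3-plan (g4) RULING #22 2026-09-02T12:30:32Z; binder∕assembler of record LH10-p01 (g5)); 2026-09-02.
-/
import Literature.NumberTheory.Rogawski1990.ArchStOrbFamHJumpSideH          -- ★ p850542 (LH10-p02 (g4)): the H-SIDE HEAD `stOrbFamH_jumpSide_std` (one jumping product bump per wall, Cayley value `≠ 0`)
import Literature.NumberTheory.Rogawski1990.ArchStOrbFamHJumpSideHStatement -- ★ p850593: `ne_zero_of_sharedLink` (`μ₀′ ≠ 0` from the (LINK) conjunct)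
import Literature.NumberTheory.Automorphic.ArchSharedRankOneDatum            -- ★ p850571 (F0P3-p02 (g18)): `sharedRankOneDatum_exists`
import Literature.NumberTheory.Rogawski1990.ArchJumpBricksOfSides            -- ★ p850412 (LH4-p03 (g4)): `exists_hcSemireg_zero_two`; brings ★ `jcH_eq_of_hasOneSidedJump`, `hcSemireg_zero_two_hreg`
import Literature.NumberTheory.Rogawski1990.ArchTransfFamilyJumpKit          -- ★ (LH7-p02): `slotSign_zero_ne_two_of_mem_splitChartPlaces`
import Literature.NumberTheory.Automorphic.UnitaryFormGroupUnimodular        -- ★ `locallyCompactSpace_unitaryGroupOfForm_complex`, `secondCountableTopology_unitaryGroupOfForm_complex`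
import HarnessLib

/-!
# The jump datum of Bouaziz's space is PINNED by the genuine stable families: two forward-compatible data agree at every wall, so surjectivity
# for ONE forward-compatible datum gives surjectivity for ALL of them (Bouaziz 1994 §3.2 (I₃), Thm. 6.2.1; Shelstad 1979 Thm. 4.7)

Topic `NumberTheory/Rogawski1990`; namespace `Literature.NumberTheory.Rogawski1990`.  THEOREMS ONLY (no `def`, no instance, no notation, no axiom, no named fact,
no `sorry`); kernel lane `--kind proof --supports stmt-HodgeConjecture-24833`.  Cell `pub/hodgecm-mathlib`, crux H413 = `stmt-HodgeConjecture-24833`; line LH3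
(closer stub `stub_N9`), leaf `F0_P3c_StubN9Direct`, letter **L3′** split «FORWARD ⊕ SURJ-OF-FORWARD» (LH3-plan (g4) RULING #22): the registered organ
`BouazizSurjOfForwardStatement` quantifies over EVERY forward-compatible jump datum `jcH` (every `jcH` with `stOrbFamH L νH (C_c^∞(H_∞)) ⊆ ArchBouazizSpaceH jcH`),
while any surjectivity road produces its witnesses for ONE datum.  This file is the PINNING LEMMA that closes the gap, so that the SURJ road may work with whichever
datum it likes (the forward payer's `Classical.choose`, or its own explicit constants).

THE MATHEMATICS.  (I₃) reads `jcH S w₀` only at walls `w₀ ∉ S` (★ `ArchBzJump`), and at ORDER 0 it says that `ν ↦ Ψ S (s + ν·nrm w₀)` jumps by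
`jcH S w₀ · Ψ (insert w₀ S) (cayPt w₀ s)` at every semiregular wall point `s` (★ `ArchBzJump.order_zero`).  One-sided jumps are unique (★ `HasOneSidedJump.unique`), so
two data `jcH`, `jcH′` satisfied by the SAME family `Ψ` agree at the wall `(S, w₀)` as soon as ONE Cayley value `Ψ (insert w₀ S) (cayPt w₀ s)` is non-zero
(§1, group-free).  For the genuine families this non-vanishing is supplied, at EVERY wall, by the H-side head of organ J (★ `stOrbFamH_jumpSide_std` over the shared
rank-one datum ★ `sharedRankOneDatum_exists`: a product bump `fH ∈ C_c^∞(H_∞)` whose stable family jumps by `(2·I·C₁∕C₂)·` its Cayley value, that value `≠ 0`) — its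
`G′`-frame guard «`w₀` covered, `S` admissible for `diag α`» is idle on the `H` side and is discharged here with the all-indefinite frame `α₀ = (1, 1, −1)` (§2).  Hence
(§3) every forward-compatible datum takes the SAME value `2·I·C₁∕C₂` at every wall — in particular any two forward-compatible data agree at all walls, and
`ArchBouazizSpaceH jcH = ArchBouazizSpaceH jcH′` as predicates; (§4) surjectivity `ArchBouazizSpaceH jcH₀ ⊆ stOrbFamH(C_c^∞) |_{RegS}` for ONE forward-compatible
`jcH₀` gives it for every forward-compatible `jcH` — the text of `BouazizSurjOfForwardStatement` after its `∀ L … νH` frame.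

* §1 (group-free, any finite index type `W`): `archBzJump_of_eqOn_walls`, `archBouazizSpaceH_of_eqOn_walls`, `archBouazizSpaceH_iff_of_eqOn_walls` (transport of the
  predicates along wall-agreement of the data); **`jcH_eq_jcH_of_archBzJump`** (two (I₃)-data of one family agree at a wall with a non-zero Cayley value).
* §2 (the all-indefinite frame `α₀ = ![1, 1, -1]`): `oneOneNegOne_ne_zero`, `im_embedding_oneOneNegOne`, `formSign_oneOneNegOne_not_definite`,
  `mem_splitChartPlaces_oneOneNegOne` (every complex place is a split-chart place), `isCoveredWall_oneOneNegOne` (every wall `w₀ ∉ S` is covered).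
* §3 (the genuine families, frame `(L, νH)`): **`exists_const_forall_forward_jcH_eq`** — `∃ c ≠ 0, ∀ jcH` forward-compatible, `∀ S w₀ ∉ S, jcH S w₀ = c`;
  **`jcH_eq_jcH_of_forward`** (two forward-compatible data agree at every wall); `archBouazizSpaceH_iff_of_forward` (their spaces coincide).
* §4 **`bouazizSurjOfForward_of_one`** — SURJ for one forward-compatible datum ⟹ SURJ for every forward-compatible datum (the organ's body); and the
  `∀`-closed corollary `bouazizSurjOfForward_of_exists` (hypothesis: `∃ jcH₀` forward-compatible AND surjective ⟹ the organ text for all `jcH`).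
HONEST LABEL: HC_CM is proved only modulo the 7 printed citations (2 remaining: hLiu418 = `stmt-HodgeConjecture-24832`, h413 = `stmt-HodgeConjecture-24833`) until
rung 0 closes; this file is a pure-logic seam of letter L3′ (count-neutral) — Bouaziz's surjectivity itself (Thm. 6.2.1) is NOT proved here.

## References
* [Bouaziz1994IntegralesOrbitales] A. Bouaziz, *Intégrales orbitales sur les groupes de Lie réductifs*, Ann. Sci. ÉNS 27 (1994) 573–609, §3.2 (I₃) p. 580, §6.2 p. 591,
  Thm. 6.2.1 (i) p. 592.
* [Shelstad1979] D. Shelstad, *Characters and inner forms of a quasi-split group over ℝ*, Compositio Math. 39 (1979) 11–45, §4 Lemma 4.3 p. 25, Thm. 4.7 (IIIb) p. 31.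
* [Rogawski1990] J. D. Rogawski, *Automorphic Representations of Unitary Groups in Three Variables*, Ann. of Math. Stud. 123 (1990), §3.6 p. 31, §8.2 pp. 118–124.
-/

set_option autoImplicit false

noncomputable section

open Filter Topology Complex MeasureTheory MeasureTheory.Measure NumberField NumberField.InfinitePlace
open scoped Classical
open Literature.NumberTheory.Automorphic Literature.NumberTheory.Automorphic.UnitaryGroup Literature.NumberTheory.Automorphic.ArchCartan
open Literature.NumberTheory.Automorphic.Shelstad1979.StableOrbitalIntegrals
open Literature.NumberTheory.GaloisRepresentations

namespace Literature.NumberTheory.Rogawski1990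

/-! ## §1 Group-free: transport along wall-agreement, and the two-data pin -/

section Generic

variable {W : Type*} [Fintype W] [DecidableEq W]

/-- **(I₃) reads the datum only at walls**: if `jcH` and `jcH′` agree at every wall `(S, w₀)`, `w₀ ∉ S`, then `ArchBzJump jcH Ψ → ArchBzJump jcH′ Ψ`.
[cite: Bouaziz1994IntegralesOrbitales, §3.2 (I₃) p. 580] -/
theorem archBzJump_of_eqOn_walls {jcH jcH' : Finset W → W → ℂ} (h : ∀ (S : Finset W) (w₀ : W), w₀ ∉ S → jcH S w₀ = jcH' S w₀)
    {Ψ : Finset W → (W → Fin 3 → ℝ) → ℂ} (hΨ : ArchBzJump jcH Ψ) : ArchBzJump jcH' Ψ := by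
  intro S w₀ hw₀ s hs hreg hregS n m
  rw [← h S w₀ hw₀]
  exact hΨ S w₀ hw₀ s hs hreg hregS n m

/-- **Bouaziz's space depends on the datum only through its wall values**: wall-agreement transports membership. [cite: Bouaziz1994IntegralesOrbitales, §3.2 p. 580; §6.2 p. 591] -/
theorem archBouazizSpaceH_of_eqOn_walls {jcH jcH' : Finset W → W → ℂ} (h : ∀ (S : Finset W) (w₀ : W), w₀ ∉ S → jcH S w₀ = jcH' S w₀)
    {Ψ : Finset W → (W → Fin 3 → ℝ) → ℂ} (hΨ : ArchBouazizSpaceH jcH Ψ) : ArchBouazizSpaceH jcH' Ψ :=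
  ⟨hΨ.periodic, hΨ.weyl, hΨ.smoothBounded, archBzJump_of_eqOn_walls h hΨ.jump, hΨ.compactSupport⟩

/-- Wall-agreement of the data makes the two spaces EQUAL as predicates. [cite: Bouaziz1994IntegralesOrbitales, §6.2 p. 591] -/
theorem archBouazizSpaceH_iff_of_eqOn_walls {jcH jcH' : Finset W → W → ℂ} (h : ∀ (S : Finset W) (w₀ : W), w₀ ∉ S → jcH S w₀ = jcH' S w₀)
    (Ψ : Finset W → (W → Fin 3 → ℝ) → ℂ) : ArchBouazizSpaceH jcH Ψ ↔ ArchBouazizSpaceH jcH' Ψ :=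
  ⟨archBouazizSpaceH_of_eqOn_walls h, archBouazizSpaceH_of_eqOn_walls fun S w₀ hw₀ => (h S w₀ hw₀).symm⟩

/-- **THE TWO-DATA PIN (group-free)**: if ONE family `Ψ` satisfies (I₃) with constants `jcH` AND with constants `jcH′`, then at every wall `(S, w₀)` carrying a
semiregular point `s` with non-zero Cayley value `Ψ (insert w₀ S) (cayPt w₀ s) ≠ 0` the two constants agree: both order-`0` readings (★ `ArchBzJump.order_zero`) are
one-sided jumps of the same function, hence equal (★ `HasOneSidedJump.unique`), and the Cayley value cancels (★ `jcH_eq_of_hasOneSidedJump`).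
[cite: Bouaziz1994IntegralesOrbitales, §3.2 (I₃) p. 580] [cite: Shelstad1979, Thm. 4.7 (IIIb) (p. 31)] -/
theorem jcH_eq_jcH_of_archBzJump {jcH jcH' : Finset W → W → ℂ} {Ψ : Finset W → (W → Fin 3 → ℝ) → ℂ} (hBZ : ArchBzJump jcH Ψ) (hBZ' : ArchBzJump jcH' Ψ)
    {S : Finset W} {w₀ : W} (hw₀ : w₀ ∉ S) {s : W → Fin 3 → ℝ} (hs : s w₀ 0 = s w₀ 2)
    (hreg : ∀ w, w ∉ S → w ≠ w₀ → Circle.exp (s w 0) ≠ Circle.exp (s w 2)) (hregS : ∀ w ∈ S, s w 0 ≠ 0)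
    (hne : Ψ (insert w₀ S) (cayPt w₀ s) ≠ 0) : jcH S w₀ = jcH' S w₀ :=
  jcH_eq_of_hasOneSidedJump hBZ hw₀ hs hreg hregS (hBZ'.order_zero hw₀ hs hreg hregS) hne

end Generic

/-! ## §2 The all-indefinite frame `α₀ = (1, 1, −1)`: every complex place is a split-chart place, every wall is covered -/

section Frame

variable (L : Type) [Field L]

/-- `α₀ = (1, 1, −1)` has non-zero entries. [cite: Rogawski1990, §3.6 p. 31] -/
theorem oneOneNegOne_ne_zero (i : Fin 3) : (![(1 : L), 1, -1] : Fin 3 → L) i ≠ 0 := by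
  fin_cases i <;> simp

/-- `σ_w(α₀)` is real at every complex place. [cite: Rogawski1990, §3.6 p. 31] -/
theorem im_embedding_oneOneNegOne (w : {w : InfinitePlace L // IsComplex w}) (i : Fin 3) : (w.1.embedding ((![(1 : L), 1, -1] : Fin 3 → L) i)).im = 0 := by
  fin_cases i <;> simp

/-- The sign pattern of `α₀` at every complex place is `(+, +, −)`: NOT definite. [cite: Rogawski1990, §3.6 p. 31; §14.2 p. 232] -/
theorem formSign_oneOneNegOne_not_definite (w : {w : InfinitePlace L // IsComplex w}) :
    ¬ (formSign L ![(1 : L), 1, -1] w 0 = formSign L ![(1 : L), 1, -1] w 1 ∧ formSign L ![(1 : L), 1, -1] w 1 = formSign L ![(1 : L), 1, -1] w 2) := by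
  intro h
  have h12 := h.2
  simp [formSign, formRe] at h12

/-- **Every complex place is a split-chart place of the frame `α₀`** (★ `mem_splitChartPlaces_of_frame`). [cite: Rogawski1990, §3.6 p. 31] -/
theorem mem_splitChartPlaces_oneOneNegOne (w : {w : InfinitePlace L // IsComplex w}) : w ∈ splitChartPlaces L ![(1 : L), 1, -1] :=
  mem_splitChartPlaces_of_frame (oneOneNegOne_ne_zero L) (im_embedding_oneOneNegOne L w) (formSign_oneOneNegOne_not_definite L w)

/-- **Every wall `(S, w₀)`, `w₀ ∉ S`, is COVERED for the frame `α₀`** (★ `slotSign_zero_ne_two_of_mem_splitChartPlaces`). [cite: Rogawski1990, §14.2 p. 232] -/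
theorem isCoveredWall_oneOneNegOne (S : Finset {w : InfinitePlace L // IsComplex w}) {w₀ : {w : InfinitePlace L // IsComplex w}} (hw₀ : w₀ ∉ S) :
    IsCoveredWall (slotSign L ![(1 : L), 1, -1]) S w₀ :=
  ⟨hw₀, (slotSign_zero_ne_two_of_mem_splitChartPlaces L ![(1 : L), 1, -1] (oneOneNegOne_ne_zero L) (mem_splitChartPlaces_oneOneNegOne L w₀)).2⟩

end Frame

/-! ## §3 The genuine families pin every forward-compatible datum -/

section HSide

variable (L : Type) [Field L] [NumberField L] [IsCMField L]
  [MeasurableSpace (↥(arch (↥(maximalRealSubfield L)) L (IsCMField.complexConj L) 2 (Matrix.of fun i j : Fin 2 => if i.val + j.val + 1 = 2 then (1 : L) else 0)) ×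
      ↥(arch (↥(maximalRealSubfield L)) L (IsCMField.complexConj L) 1 (Matrix.of fun i j : Fin 1 => if i.val + j.val + 1 = 1 then (1 : L) else 0)))]
  [BorelSpace (↥(arch (↥(maximalRealSubfield L)) L (IsCMField.complexConj L) 2 (Matrix.of fun i j : Fin 2 => if i.val + j.val + 1 = 2 then (1 : L) else 0)) ×
      ↥(arch (↥(maximalRealSubfield L)) L (IsCMField.complexConj L) 1 (Matrix.of fun i j : Fin 1 => if i.val + j.val + 1 = 1 then (1 : L) else 0)))]
  (νH : Measure (↥(arch (↥(maximalRealSubfield L)) L (IsCMField.complexConj L) 2 (Matrix.of fun i j : Fin 2 => if i.val + j.val + 1 = 2 then (1 : L) else 0)) ×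
      ↥(arch (↥(maximalRealSubfield L)) L (IsCMField.complexConj L) 1 (Matrix.of fun i j : Fin 1 => if i.val + j.val + 1 = 1 then (1 : L) else 0))))
  [νH.IsHaarMeasure] [νH.IsMulRightInvariant]

/-- **ONE JUMPING GENUINE FAMILY WITH NON-ZERO CAYLEY VALUE AT EVERY WALL, WITH A UNIVERSAL CONSTANT — on a standard carrier `U(J)`, `J = Φ₂ over ℂ`.**
If every `fH ∈ C_c^∞(H_∞)` has `SO^{H,st}(fH)` smooth-bounded ((I₁)+(I₂), the `hsmH` binder of the H-side head), there is ONE constant `c ≠ 0` (`= 2·I·C₁∕C₂` of the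
shared rank-one datum ★ `sharedRankOneDatum_exists` on `U(J)`) such that at EVERY wall `(S, w₀)`, `w₀ ∉ S`, some `G`-semiregular wall point `s` (★ `exists_hcSemireg_zero_two`)
carries a smooth `fH` whose stable family jumps across the wall by `c ·` its Cayley value, that value `≠ 0` — ★ `stOrbFamH_jumpSide_std` in the all-indefinite frame `α₀`
(§2 discharges its idle `G′`-guard; `μ₀′ ≠ 0` by ★ `ne_zero_of_sharedLink` after `J := σ_{w₀} Φ₂`).
[cite: Shelstad1979, Lemma 4.3 (p. 25); Thm. 4.7 (IIIb) (p. 31)] [cite: Rogawski1990, §8.2 pp. 119–122] [cite: Bouaziz1994IntegralesOrbitales, §3.2 (I₃) p. 580] -/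
theorem exists_const_forall_wall_hasOneSidedJump_stOrbFamH_of_eq_over
    {J : Matrix (Fin 2) (Fin 2) ℂ} (hJ : J = (StdForm.antidiagonal 2).over ℂ)
    [MeasurableSpace ↥(unitaryGroupOfForm (starRingEnd ℂ) J)] [BorelSpace ↥(unitaryGroupOfForm (starRingEnd ℂ) J)]
    [LocallyCompactSpace ↥(unitaryGroupOfForm (starRingEnd ℂ) J)] [SecondCountableTopology ↥(unitaryGroupOfForm (starRingEnd ℂ) J)]
    [MeasurableSpace (↥(unitaryGroupOfForm (starRingEnd ℂ) J) ⧸ torusU (starRingEnd ℂ) J)] [BorelSpace (↥(unitaryGroupOfForm (starRingEnd ℂ) J) ⧸ torusU (starRingEnd ℂ) J)]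
    (hsmH : ∀ fH : (↥(arch (↥(maximalRealSubfield L)) L (IsCMField.complexConj L) 2 (Matrix.of fun i j : Fin 2 => if i.val + j.val + 1 = 2 then (1 : L) else 0)) ×
        ↥(arch (↥(maximalRealSubfield L)) L (IsCMField.complexConj L) 1 (Matrix.of fun i j : Fin 1 => if i.val + j.val + 1 = 1 then (1 : L) else 0))) → ℂ,
      ArchSmooth₂ L fH → ArchBzSmoothBounded (stOrbFamH L νH fH)) :
    ∃ c : ℂ, c ≠ 0 ∧ ∀ (S : Finset {w : InfinitePlace L // IsComplex w}) (w₀ : {w : InfinitePlace L // IsComplex w}), w₀ ∉ S →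
      ∃ s : {w : InfinitePlace L // IsComplex w} → Fin 3 → ℝ, HcSemireg S w₀ 0 2 s ∧
        ∃ fH : (↥(arch (↥(maximalRealSubfield L)) L (IsCMField.complexConj L) 2 (Matrix.of fun i j : Fin 2 => if i.val + j.val + 1 = 2 then (1 : L) else 0)) ×
            ↥(arch (↥(maximalRealSubfield L)) L (IsCMField.complexConj L) 1 (Matrix.of fun i j : Fin 1 => if i.val + j.val + 1 = 1 then (1 : L) else 0))) → ℂ,
          ArchSmooth₂ L fH ∧
            HasOneSidedJump (fun ν : ℝ => stOrbFamH L νH fH S (s + ν • nrm w₀)) (c * stOrbFamH L νH fH (insert w₀ S) (cayPt w₀ s)) ∧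
            stOrbFamH L νH fH (insert w₀ S) (cayPt w₀ s) ≠ 0 := by
  obtain ⟨μ₀, hμ₀, hμ₀r, μ₀', hsm, hfin, C₁, C₂, hC₁, hC₂, hK0, hA0, hlink⟩ := sharedRankOneDatum_exists hJ
  refine ⟨2 * I * C₁ / C₂, ?_, fun S w₀ hw₀ => ?_⟩
  · have h1 : (C₁ : ℂ) ≠ 0 := Complex.ofReal_ne_zero.2 hC₁.ne'
    have h2 : (C₂ : ℂ) ≠ 0 := Complex.ofReal_ne_zero.2 hC₂.ne'
    exact div_ne_zero (mul_ne_zero (mul_ne_zero two_ne_zero Complex.I_ne_zero) h1) h2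
  · obtain ⟨s, hs⟩ := exists_hcSemireg_zero_two S hw₀
    -- `σ_{w₀} Φ₂ = Φ₂ over ℂ = J`: read the datum on the carrier `U(σ_{w₀} Φ₂)`
    have hJ₀ : ((Matrix.of fun i j : Fin 2 => if i.val + j.val + 1 = 2 then (1 : L) else 0).map w₀.1.embedding) = (StdForm.antidiagonal 2).over ℂ := by
      rw [antidiagOne_map, StdForm.over_antidiagonal_eq]
    obtain rfl : J = ((Matrix.of fun i j : Fin 2 => if i.val + j.val + 1 = 2 then (1 : L) else 0).map w₀.1.embedding) := hJ.trans hJ₀.symm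
    have hμ₀' : μ₀' ≠ 0 := ne_zero_of_sharedLink L w₀ hJ μ₀ μ₀' hlink
    obtain ⟨fH, hfH, hJmp, hne⟩ := stOrbFamH_jumpSide_std L ![(1 : L), 1, -1] νH hJ μ₀ μ₀' C₁ C₂ hC₂ hK0 hA0 hμ₀'
      (fun ρ _ _ _ _ => by
        haveI : ρ.IsHaarMeasure := { }
        exact hlink ρ)
      S w₀ s (fun w' _ => mem_splitChartPlaces_oneOneNegOne L w') (isCoveredWall_oneOneNegOne L S hw₀) hs hsmH
    exact ⟨s, hs, fH, hfH, hJmp, hne⟩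

/-- **ONE JUMPING GENUINE FAMILY WITH NON-ZERO CAYLEY VALUE AT EVERY WALL, WITH A UNIVERSAL CONSTANT** (`exists_const_forall_wall_hasOneSidedJump_stOrbFamH_of_eq_over` on the
standard carrier `U(Φ₂ over ℂ)` with its Borel structures, ★ `locallyCompactSpace_∕secondCountableTopology_unitaryGroupOfForm_complex`).
[cite: Shelstad1979, Lemma 4.3 (p. 25); Thm. 4.7 (IIIb) (p. 31)] [cite: Rogawski1990, §8.2 pp. 119–122] [cite: Bouaziz1994IntegralesOrbitales, §3.2 (I₃) p. 580] -/
theorem exists_const_forall_wall_hasOneSidedJump_stOrbFamH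
    (hsmH : ∀ fH : (↥(arch (↥(maximalRealSubfield L)) L (IsCMField.complexConj L) 2 (Matrix.of fun i j : Fin 2 => if i.val + j.val + 1 = 2 then (1 : L) else 0)) ×
        ↥(arch (↥(maximalRealSubfield L)) L (IsCMField.complexConj L) 1 (Matrix.of fun i j : Fin 1 => if i.val + j.val + 1 = 1 then (1 : L) else 0))) → ℂ,
      ArchSmooth₂ L fH → ArchBzSmoothBounded (stOrbFamH L νH fH)) :
    ∃ c : ℂ, c ≠ 0 ∧ ∀ (S : Finset {w : InfinitePlace L // IsComplex w}) (w₀ : {w : InfinitePlace L // IsComplex w}), w₀ ∉ S →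
      ∃ s : {w : InfinitePlace L // IsComplex w} → Fin 3 → ℝ, HcSemireg S w₀ 0 2 s ∧
        ∃ fH : (↥(arch (↥(maximalRealSubfield L)) L (IsCMField.complexConj L) 2 (Matrix.of fun i j : Fin 2 => if i.val + j.val + 1 = 2 then (1 : L) else 0)) ×
            ↥(arch (↥(maximalRealSubfield L)) L (IsCMField.complexConj L) 1 (Matrix.of fun i j : Fin 1 => if i.val + j.val + 1 = 1 then (1 : L) else 0))) → ℂ,
          ArchSmooth₂ L fH ∧
            HasOneSidedJump (fun ν : ℝ => stOrbFamH L νH fH S (s + ν • nrm w₀)) (c * stOrbFamH L νH fH (insert w₀ S) (cayPt w₀ s)) ∧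
            stOrbFamH L νH fH (insert w₀ S) (cayPt w₀ s) ≠ 0 := by
  letI mU : MeasurableSpace ↥(unitaryGroupOfForm (starRingEnd ℂ) ((StdForm.antidiagonal 2).over ℂ)) := borel _
  haveI : BorelSpace ↥(unitaryGroupOfForm (starRingEnd ℂ) ((StdForm.antidiagonal 2).over ℂ)) := ⟨rfl⟩
  letI mQ : MeasurableSpace (↥(unitaryGroupOfForm (starRingEnd ℂ) ((StdForm.antidiagonal 2).over ℂ)) ⧸ torusU (starRingEnd ℂ) ((StdForm.antidiagonal 2).over ℂ)) := borel _
  haveI : BorelSpace (↥(unitaryGroupOfForm (starRingEnd ℂ) ((StdForm.antidiagonal 2).over ℂ)) ⧸ torusU (starRingEnd ℂ) ((StdForm.antidiagonal 2).over ℂ)) := ⟨rfl⟩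
  haveI := locallyCompactSpace_unitaryGroupOfForm_complex ((StdForm.antidiagonal 2).over ℂ)
  haveI := secondCountableTopology_unitaryGroupOfForm_complex ((StdForm.antidiagonal 2).over ℂ)
  exact exists_const_forall_wall_hasOneSidedJump_stOrbFamH_of_eq_over L νH rfl hsmH

/-- **EVERY FORWARD-COMPATIBLE DATUM IS THE SAME CONSTANT AT EVERY WALL.**  There is `c ≠ 0` such that for every `jcH` with `stOrbFamH L νH (C_c^∞(H_∞)) ⊆ ArchBouazizSpaceH jcH`
and every wall `(S, w₀)`, `w₀ ∉ S`: `jcH S w₀ = c` (★ `jcH_eq_of_hasOneSidedJump` on the jumping family of `exists_const_forall_wall_hasOneSidedJump_stOrbFamH`; (I₁)+(I₂) for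
the genuine families is the datum's own clause ★ `ArchBouazizSpaceH.smoothBounded`). [cite: Bouaziz1994IntegralesOrbitales, §3.2 (I₃) p. 580; Thm. 6.2.1 (i) p. 592]
[cite: Shelstad1979, Thm. 4.7 (IIIb) (p. 31)] -/
theorem exists_const_forall_forward_jcH_eq :
    ∃ c : ℂ, c ≠ 0 ∧ ∀ jcH : Finset {w : InfinitePlace L // IsComplex w} → {w : InfinitePlace L // IsComplex w} → ℂ,
      (∀ fH : (↥(arch (↥(maximalRealSubfield L)) L (IsCMField.complexConj L) 2 (Matrix.of fun i j : Fin 2 => if i.val + j.val + 1 = 2 then (1 : L) else 0)) ×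
          ↥(arch (↥(maximalRealSubfield L)) L (IsCMField.complexConj L) 1 (Matrix.of fun i j : Fin 1 => if i.val + j.val + 1 = 1 then (1 : L) else 0))) → ℂ,
        ArchSmooth₂ L fH → ArchBouazizSpaceH jcH (stOrbFamH L νH fH)) →
      ∀ (S : Finset {w : InfinitePlace L // IsComplex w}) (w₀ : {w : InfinitePlace L // IsComplex w}), w₀ ∉ S → jcH S w₀ = c := by
  by_cases hex : ∃ jcH₀ : Finset {w : InfinitePlace L // IsComplex w} → {w : InfinitePlace L // IsComplex w} → ℂ,
      ∀ fH : (↥(arch (↥(maximalRealSubfield L)) L (IsCMField.complexConj L) 2 (Matrix.of fun i j : Fin 2 => if i.val + j.val + 1 = 2 then (1 : L) else 0)) ×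
          ↥(arch (↥(maximalRealSubfield L)) L (IsCMField.complexConj L) 1 (Matrix.of fun i j : Fin 1 => if i.val + j.val + 1 = 1 then (1 : L) else 0))) → ℂ,
        ArchSmooth₂ L fH → ArchBouazizSpaceH jcH₀ (stOrbFamH L νH fH)
  · -- (I₁)+(I₂) for the genuine families, from any forward-compatible datum
    obtain ⟨jcH₀, h₀⟩ := hex
    obtain ⟨c, hc, hwall⟩ := exists_const_forall_wall_hasOneSidedJump_stOrbFamH L νH fun fH hfH => (h₀ fH hfH).smoothBounded
    refine ⟨c, hc, fun jcH hjcH S w₀ hw₀ => ?_⟩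
    obtain ⟨s, hs, fH, hfH, hJ, hne⟩ := hwall S w₀ hw₀
    obtain ⟨hs02, hreg, hregS⟩ := hcSemireg_zero_two_hreg hs
    exact jcH_eq_of_hasOneSidedJump (hjcH fH hfH).jump hw₀ hs02 hreg hregS hJ hne
  · -- no forward-compatible datum: the claim is vacuous
    refine ⟨1, one_ne_zero, fun jcH hjcH => absurd ⟨jcH, hjcH⟩ hex⟩

/-- **TWO FORWARD-COMPATIBLE DATA AGREE AT EVERY WALL.** [cite: Bouaziz1994IntegralesOrbitales, §3.2 (I₃) p. 580; Thm. 6.2.1 (i) p. 592] [cite: Shelstad1979, Thm. 4.7 (IIIb) (p. 31)] -/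
theorem jcH_eq_jcH_of_forward {jcH jcH' : Finset {w : InfinitePlace L // IsComplex w} → {w : InfinitePlace L // IsComplex w} → ℂ}
    (h : ∀ fH : (↥(arch (↥(maximalRealSubfield L)) L (IsCMField.complexConj L) 2 (Matrix.of fun i j : Fin 2 => if i.val + j.val + 1 = 2 then (1 : L) else 0)) ×
        ↥(arch (↥(maximalRealSubfield L)) L (IsCMField.complexConj L) 1 (Matrix.of fun i j : Fin 1 => if i.val + j.val + 1 = 1 then (1 : L) else 0))) → ℂ,
      ArchSmooth₂ L fH → ArchBouazizSpaceH jcH (stOrbFamH L νH fH))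
    (h' : ∀ fH : (↥(arch (↥(maximalRealSubfield L)) L (IsCMField.complexConj L) 2 (Matrix.of fun i j : Fin 2 => if i.val + j.val + 1 = 2 then (1 : L) else 0)) ×
        ↥(arch (↥(maximalRealSubfield L)) L (IsCMField.complexConj L) 1 (Matrix.of fun i j : Fin 1 => if i.val + j.val + 1 = 1 then (1 : L) else 0))) → ℂ,
      ArchSmooth₂ L fH → ArchBouazizSpaceH jcH' (stOrbFamH L νH fH)) :
    ∀ (S : Finset {w : InfinitePlace L // IsComplex w}) (w₀ : {w : InfinitePlace L // IsComplex w}), w₀ ∉ S → jcH S w₀ = jcH' S w₀ := by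
  obtain ⟨c, _, hc⟩ := exists_const_forall_forward_jcH_eq L νH
  intro S w₀ hw₀
  rw [hc jcH h S w₀ hw₀, hc jcH' h' S w₀ hw₀]

/-- **The Bouaziz spaces of two forward-compatible data COINCIDE** (as predicates on families). [cite: Bouaziz1994IntegralesOrbitales, §6.2 p. 591; Thm. 6.2.1 (i) p. 592] -/
theorem archBouazizSpaceH_iff_of_forward {jcH jcH' : Finset {w : InfinitePlace L // IsComplex w} → {w : InfinitePlace L // IsComplex w} → ℂ}
    (h : ∀ fH : (↥(arch (↥(maximalRealSubfield L)) L (IsCMField.complexConj L) 2 (Matrix.of fun i j : Fin 2 => if i.val + j.val + 1 = 2 then (1 : L) else 0)) ×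
        ↥(arch (↥(maximalRealSubfield L)) L (IsCMField.complexConj L) 1 (Matrix.of fun i j : Fin 1 => if i.val + j.val + 1 = 1 then (1 : L) else 0))) → ℂ,
      ArchSmooth₂ L fH → ArchBouazizSpaceH jcH (stOrbFamH L νH fH))
    (h' : ∀ fH : (↥(arch (↥(maximalRealSubfield L)) L (IsCMField.complexConj L) 2 (Matrix.of fun i j : Fin 2 => if i.val + j.val + 1 = 2 then (1 : L) else 0)) ×
        ↥(arch (↥(maximalRealSubfield L)) L (IsCMField.complexConj L) 1 (Matrix.of fun i j : Fin 1 => if i.val + j.val + 1 = 1 then (1 : L) else 0))) → ℂ,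
      ArchSmooth₂ L fH → ArchBouazizSpaceH jcH' (stOrbFamH L νH fH))
    (Ψ : Finset {w : InfinitePlace L // IsComplex w} → ({w : InfinitePlace L // IsComplex w} → Fin 3 → ℝ) → ℂ) :
    ArchBouazizSpaceH jcH Ψ ↔ ArchBouazizSpaceH jcH' Ψ :=
  archBouazizSpaceH_iff_of_eqOn_walls (jcH_eq_jcH_of_forward L νH h h') Ψ

/-! ## §4 Surjectivity for ONE forward-compatible datum is surjectivity for ALL of them -/

/-- **SURJ-OF-FORWARD FROM ONE DATUM.**  If some forward-compatible datum `jcH₀` (`stOrbFamH L νH (C_c^∞(H_∞)) ⊆ ArchBouazizSpaceH jcH₀`) is SURJECTIVE (every member of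
`ArchBouazizSpaceH jcH₀` is, on each regular set `RegS S`, the stable family of some smooth `fH`), then so is every forward-compatible datum `jcH`: its space IS the space
of `jcH₀` (`archBouazizSpaceH_iff_of_forward`).  This is the body of the leaf organ `BouazizSurjOfForwardStatement` (LH3-plan (g4) RULING #22) after its frame, reduced to ONE
datum of the surjectivity road's choosing. [cite: Bouaziz1994IntegralesOrbitales, Thm. 6.2.1 (i) p. 592; §6.2 p. 591] [cite: Shelstad1979, Thm. 4.7 (p. 31)] -/
theorem bouazizSurjOfForward_of_one
    (jcH₀ : Finset {w : InfinitePlace L // IsComplex w} → {w : InfinitePlace L // IsComplex w} → ℂ)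
    (h₀ : ∀ fH : (↥(arch (↥(maximalRealSubfield L)) L (IsCMField.complexConj L) 2 (Matrix.of fun i j : Fin 2 => if i.val + j.val + 1 = 2 then (1 : L) else 0)) ×
        ↥(arch (↥(maximalRealSubfield L)) L (IsCMField.complexConj L) 1 (Matrix.of fun i j : Fin 1 => if i.val + j.val + 1 = 1 then (1 : L) else 0))) → ℂ,
      ArchSmooth₂ L fH → ArchBouazizSpaceH jcH₀ (stOrbFamH L νH fH))
    (hsurj₀ : ∀ Ψ : Finset {w : InfinitePlace L // IsComplex w} → ({w : InfinitePlace L // IsComplex w} → Fin 3 → ℝ) → ℂ, ArchBouazizSpaceH jcH₀ Ψ →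
      ∃ fH : (↥(arch (↥(maximalRealSubfield L)) L (IsCMField.complexConj L) 2 (Matrix.of fun i j : Fin 2 => if i.val + j.val + 1 = 2 then (1 : L) else 0)) ×
          ↥(arch (↥(maximalRealSubfield L)) L (IsCMField.complexConj L) 1 (Matrix.of fun i j : Fin 1 => if i.val + j.val + 1 = 1 then (1 : L) else 0))) → ℂ,
        ArchSmooth₂ L fH ∧ ∀ S : Finset {w : InfinitePlace L // IsComplex w}, Set.EqOn (stOrbFamH L νH fH S) (Ψ S) (RegS S))
    (jcH : Finset {w : InfinitePlace L // IsComplex w} → {w : InfinitePlace L // IsComplex w} → ℂ)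
    (h : ∀ fH : (↥(arch (↥(maximalRealSubfield L)) L (IsCMField.complexConj L) 2 (Matrix.of fun i j : Fin 2 => if i.val + j.val + 1 = 2 then (1 : L) else 0)) ×
        ↥(arch (↥(maximalRealSubfield L)) L (IsCMField.complexConj L) 1 (Matrix.of fun i j : Fin 1 => if i.val + j.val + 1 = 1 then (1 : L) else 0))) → ℂ,
      ArchSmooth₂ L fH → ArchBouazizSpaceH jcH (stOrbFamH L νH fH)) :
    ∀ Ψ : Finset {w : InfinitePlace L // IsComplex w} → ({w : InfinitePlace L // IsComplex w} → Fin 3 → ℝ) → ℂ, ArchBouazizSpaceH jcH Ψ →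
      ∃ fH : (↥(arch (↥(maximalRealSubfield L)) L (IsCMField.complexConj L) 2 (Matrix.of fun i j : Fin 2 => if i.val + j.val + 1 = 2 then (1 : L) else 0)) ×
          ↥(arch (↥(maximalRealSubfield L)) L (IsCMField.complexConj L) 1 (Matrix.of fun i j : Fin 1 => if i.val + j.val + 1 = 1 then (1 : L) else 0))) → ℂ,
        ArchSmooth₂ L fH ∧ ∀ S : Finset {w : InfinitePlace L // IsComplex w}, Set.EqOn (stOrbFamH L νH fH S) (Ψ S) (RegS S) :=
  fun Ψ hΨ => hsurj₀ Ψ ((archBouazizSpaceH_iff_of_forward L νH h h₀ Ψ).1 hΨ)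

/-- **SURJ-OF-FORWARD FROM AN EXISTENTIAL WITNESS** — the same with the surjective datum packaged as `∃ jcH₀, forward ∧ surjective` (the shape a surjectivity road that
builds its own datum exports). [cite: Bouaziz1994IntegralesOrbitales, Thm. 6.2.1 (i) p. 592] -/
theorem bouazizSurjOfForward_of_exists
    (hex : ∃ jcH₀ : Finset {w : InfinitePlace L // IsComplex w} → {w : InfinitePlace L // IsComplex w} → ℂ,
      (∀ fH : (↥(arch (↥(maximalRealSubfield L)) L (IsCMField.complexConj L) 2 (Matrix.of fun i j : Fin 2 => if i.val + j.val + 1 = 2 then (1 : L) else 0)) ×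
          ↥(arch (↥(maximalRealSubfield L)) L (IsCMField.complexConj L) 1 (Matrix.of fun i j : Fin 1 => if i.val + j.val + 1 = 1 then (1 : L) else 0))) → ℂ,
        ArchSmooth₂ L fH → ArchBouazizSpaceH jcH₀ (stOrbFamH L νH fH)) ∧
      ∀ Ψ : Finset {w : InfinitePlace L // IsComplex w} → ({w : InfinitePlace L // IsComplex w} → Fin 3 → ℝ) → ℂ, ArchBouazizSpaceH jcH₀ Ψ →
        ∃ fH : (↥(arch (↥(maximalRealSubfield L)) L (IsCMField.complexConj L) 2 (Matrix.of fun i j : Fin 2 => if i.val + j.val + 1 = 2 then (1 : L) else 0)) ×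
            ↥(arch (↥(maximalRealSubfield L)) L (IsCMField.complexConj L) 1 (Matrix.of fun i j : Fin 1 => if i.val + j.val + 1 = 1 then (1 : L) else 0))) → ℂ,
          ArchSmooth₂ L fH ∧ ∀ S : Finset {w : InfinitePlace L // IsComplex w}, Set.EqOn (stOrbFamH L νH fH S) (Ψ S) (RegS S))
    (jcH : Finset {w : InfinitePlace L // IsComplex w} → {w : InfinitePlace L // IsComplex w} → ℂ)
    (_hne : ∀ (S : Finset {w : InfinitePlace L // IsComplex w}) (w : {w : InfinitePlace L // IsComplex w}), w ∉ S → jcH S w ≠ 0)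
    (h : ∀ fH : (↥(arch (↥(maximalRealSubfield L)) L (IsCMField.complexConj L) 2 (Matrix.of fun i j : Fin 2 => if i.val + j.val + 1 = 2 then (1 : L) else 0)) ×
        ↥(arch (↥(maximalRealSubfield L)) L (IsCMField.complexConj L) 1 (Matrix.of fun i j : Fin 1 => if i.val + j.val + 1 = 1 then (1 : L) else 0))) → ℂ,
      ArchSmooth₂ L fH → ArchBouazizSpaceH jcH (stOrbFamH L νH fH)) :
    ∀ Ψ : Finset {w : InfinitePlace L // IsComplex w} → ({w : InfinitePlace L // IsComplex w} → Fin 3 → ℝ) → ℂ, ArchBouazizSpaceH jcH Ψ →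
      ∃ fH : (↥(arch (↥(maximalRealSubfield L)) L (IsCMField.complexConj L) 2 (Matrix.of fun i j : Fin 2 => if i.val + j.val + 1 = 2 then (1 : L) else 0)) ×
          ↥(arch (↥(maximalRealSubfield L)) L (IsCMField.complexConj L) 1 (Matrix.of fun i j : Fin 1 => if i.val + j.val + 1 = 1 then (1 : L) else 0))) → ℂ,
        ArchSmooth₂ L fH ∧ ∀ S : Finset {w : InfinitePlace L // IsComplex w}, Set.EqOn (stOrbFamH L νH fH S) (Ψ S) (RegS S) := by
  obtain ⟨jcH₀, h₀, hsurj₀⟩ := hex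
  exact bouazizSurjOfForward_of_one L νH jcH₀ h₀ hsurj₀ jcH h

end HSide

end Literature.NumberTheory.Rogawski1990

end
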